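import Literature.Geometry.Lorentzian.KerrStarCoord
import Literature.Geometry.Lorentzian.KerrSeparatedPotential
import Mathlib.Analysis.SpecialFunctions.Log.Deriv
import Mathlib.Analysis.InnerProductSpace.Calculus
import HarnessLib

/-!
# The Kerr-star coordinate shifts `t̄(r)`, `φ̄(r)` and uniform bounds for `∇r`, `Dℓ⃗` on the
# Kerr–Schild slices `{r > r₀}`

(family `gr`; chart infrastructure complementing `KerrStarCoord.lean` for transporting separated
(mode) solutions given in Boyer–Lindquist / Kerr-star variables to profiles on the Kerr–Schild leaf
with controlled decay; namespace `Literature.Geometry.Lorentzian.Kerr`)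

`KerrStarCoord.lean` identifies the prelude's ingoing Kerr–Schild Cartesian chart with Kerr's
ingoing spheroidal coordinates `(r, θ, φ*)` on the leaf (`Kerr.kerrStar`, `radius_kerrStar`,
`nullSpatial_kerrStar : ℓ⃗ = n̂(θ, φ*)`), i.e. with Shlapentokh-Rothman's Kerr-star chart
`(t* = t_KS + r, r, θ, φ*)` (CMP 329 (2014), §1.2.1). This file adds

* the **Kerr-star shifts** `starTime M a r = t̄(r)` (`dt̄/dr = (r² + a²)/Δ`) and
  `starAngle M a r = φ̄(r)` (`dφ̄/dr = a/Δ`) of SR §1.2.1 (`t* = t + t̄`, `φ* = φ + φ̄`, each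
  defined up to a constant) as explicit logarithmic primitives on `(r₊, ∞)` for sub-extremal
  parameters, with their derivatives (`hasDerivAt_starTime`, `hasDerivAt_starAngle`), smoothness,
  and the lower bound `t̄(r) − r ≥ −2M r₋` on `[r₊ + 1, ∞)` (`neg_le_starTime_sub_self`) which
  bounds the modulus of the phase `e^{iω(t̄ − r)}` relating Boyer–Lindquist modes to leaf profiles;
* leaf facts `‖ℓ⃗(0, y)‖ = 1`, `r ≤ ‖y‖`, `|y_i| ≤ r + |a|`;
* **uniform bounds on the slice `{r > r₀}`, `r₀ > 0`**: `‖∇r‖ ≤ 1 + |a|/r₀`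
  (`norm_radiusGrad_le`, from `|∇r|² = (r² + a²)/Σ ≤ 1 + a²/r²`) and, from the explicit Fréchet
  derivatives of the components `ℓ₁ = (r x + a y)/(r² + a²)`, `ℓ₂ = (r y − a x)/(r² + a²)`,
  `ℓ₃ = z/r` along the leaf (`hasFDerivAt_nullSpatial_zero/one/two`), the bound
  `‖D(y ↦ ℓ⃗(0, y))‖ ≤ (21 (1 + |a|/r₀) + 5)/r₀` (`exists_hasFDerivAt_nullSpatial_slice`,
  `norm_fderiv_nullSpatial_slice_le`): the angular frame `ℓ⃗ = n̂(θ, φ*)` varies at rate `O(1/r)`.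

Used by `Literature/Barriers/FinalStateConjecture/KleinGordonModeConstruction.lean` (decay of the
Kerr–Schild-leaf profile of a separated Klein–Gordon mode and of its derivative).

## References

* Y. Shlapentokh-Rothman, *Exponentially growing finite energy solutions for the Klein–Gordon
  equation on sub-extremal Kerr spacetimes*, CMP 329 (2014), §1.2.1 (Kerr-star coordinates
  `t* = t + t̄(r)`, `φ* = φ + φ̄(r)`) (key `ShlapentokhRothman2014KleinGordon`).
* M. Dafermos, I. Rodnianski, *Lectures on black holes and linear waves*, arXiv:0811.0354, §5.1.
* M. Visser, *The Kerr spacetime: a brief introduction*, arXiv:0706.0622, (33)–(35) (key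
  `arXiv07060622`).
-/

noncomputable section

open Set Filter
open scoped Topology Real

namespace Literature.Geometry.Lorentzian.Kerr

/-! ### Coordinate bookkeeping on the leaf -/

/-- The component `(t, y) 1 = y 0` (`x`-coordinate). [folklore] -/
theorem ofTimeSpace_apply_one_eq (t : ℝ) (y : E3) : E4.ofTimeSpace t y 1 = y 0 :=
  E4.ofTimeSpace_apply_succ t y 0

/-- The component `(t, y) 2 = y 1` (`y`-coordinate). [folklore] -/
theorem ofTimeSpace_apply_two_eq (t : ℝ) (y : E3) : E4.ofTimeSpace t y 2 = y 1 :=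
  E4.ofTimeSpace_apply_succ t y 1

/-! ### Leaf facts: `|ℓ⃗| = 1`, `r ≤ ‖y‖`, `|y_i| ≤ r + |a|` -/

section Leaf

variable {a : ℝ} {y : E3}

/-- `‖ℓ⃗(0, y)‖ = 1` wherever `r > 0` (`sum_sq_nullCovectorFun`). Visser arXiv:0706.0622,
(34)–(35). [cite: arXiv07060622, (34)–(35)] -/
theorem norm_nullSpatial_slice (hr : 0 < radius a (E4.ofTimeSpace 0 y)) :
    ‖nullSpatial a (E4.ofTimeSpace 0 y)‖ = 1 := by
  have h := sum_sq_nullCovectorFun hr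
  have hsq : ‖nullSpatial a (E4.ofTimeSpace 0 y)‖ ^ 2 = 1 := by
    rw [E3.norm_sq, nullSpatial_apply, nullSpatial_apply, nullSpatial_apply, Fin.succ_zero_eq_one,
      Fin.succ_one_eq_two, fin_succ_two_eq_three, h]
  nlinarith [norm_nonneg (nullSpatial a (E4.ofTimeSpace 0 y))]

/-- `ℓ⃗(0, y) ≠ 0` wherever `r > 0`. [folklore] -/
theorem nullSpatial_slice_ne_zero (hr : 0 < radius a (E4.ofTimeSpace 0 y)) :
    nullSpatial a (E4.ofTimeSpace 0 y) ≠ 0 := by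
  intro h
  have := norm_nullSpatial_slice hr
  rw [h, norm_zero] at this
  exact zero_ne_one this

/-- `r² ≤ ‖y‖²` hence `r ≤ ‖y‖` on the leaf (from the quartic, `r²(r² − ‖y‖²) = a²(z² − r²) ≤ 0`).
[folklore] -/
theorem radius_le_norm (hr : 0 < radius a (E4.ofTimeSpace 0 y)) :
    radius a (E4.ofTimeSpace 0 y) ≤ ‖y‖ := by
  have hq := radius_slice_quartic a y
  have hz : y 2 ^ 2 ≤ radius a (E4.ofTimeSpace 0 y) ^ 2 :=
    (sq_le_sq' (abs_le.1 (abs_apply_two_le_radius hr)).1 (abs_le.1 (abs_apply_two_le_radius hr)).2)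
  have hsq : radius a (E4.ofTimeSpace 0 y) ^ 2 ≤ ‖y‖ ^ 2 := by
    by_contra hlt
    have hlt : ‖y‖ ^ 2 < radius a (E4.ofTimeSpace 0 y) ^ 2 := lt_of_not_ge hlt
    have h1 : 0 < radius a (E4.ofTimeSpace 0 y) ^ 2 * (radius a (E4.ofTimeSpace 0 y) ^ 2 - ‖y‖ ^ 2) :=
      mul_pos (by positivity) (by linarith)
    nlinarith [sq_nonneg a]
  exact abs_le_of_sq_le_sq' hsq (norm_nonneg _) |>.2 |> fun h ↦ by
    simpa using h

/-- Each coordinate is bounded by `r + |a|` on the leaf. [folklore] -/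
theorem abs_apply_le_radius_add_abs (hr : 0 < radius a (E4.ofTimeSpace 0 y)) (i : Fin 3) :
    |y i| ≤ radius a (E4.ofTimeSpace 0 y) + |a| :=
  (Real.norm_eq_abs (y i) ▸ PiLp.norm_apply_le y i).trans (norm_le_radius_add_abs hr)

end Leaf

/-! ### The Kerr-star coordinate shifts `t̄(r)`, `φ̄(r)` -/

/-- `r₊ + r₋ = 2M`. [folklore] -/
theorem rPlus_add_rMinus (M a : ℝ) : rPlus M a + rMinus M a = 2 * M := by
  unfold rPlus rMinus; ring

/-- `r₊ r₋ = a²` for `|a| ≤ M`. O'Neill 1995, Ch. 2, §2.3. [cite: ONeill1995, Ch. 2 §2.3] -/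
theorem rPlus_mul_rMinus {M a : ℝ} (h : |a| ≤ M) : rPlus M a * rMinus M a = a ^ 2 := by
  have ha : a ^ 2 ≤ M ^ 2 := by nlinarith [sq_abs a, abs_nonneg a]
  have hs : √(M ^ 2 - a ^ 2) ^ 2 = M ^ 2 - a ^ 2 := Real.sq_sqrt (sub_nonneg.2 ha)
  unfold rPlus rMinus
  nlinarith [hs]

/-- The **Kerr-star time shift** `t̄(r)` of Shlapentokh-Rothman, CMP 329 (2014), §1.2.1
(`t* = t + t̄(r)`, `dt̄/dr = (r² + a²)/Δ`, defined up to a constant), taken for sub-extremal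
parameters as the explicit primitive
`t̄(r) = r + (2M r₊/(r₊ − r₋)) log(r − r₊) − (2M r₋/(r₊ − r₋)) log(r − r₋)` on `(r₊, ∞)` (the
tortoise coordinate `r*` up to a constant; Dafermos–Rodnianski arXiv:0811.0354, §5.1). Junk values
off `(r₊, ∞)` and for `|a| ≥ M`. [cite: ShlapentokhRothman2014KleinGordon, §1.2.1] -/
def starTime (M a r : ℝ) : ℝ :=
  r + 2 * M * rPlus M a / (rPlus M a - rMinus M a) * Real.log (r - rPlus M a) -
    2 * M * rMinus M a / (rPlus M a - rMinus M a) * Real.log (r - rMinus M a)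

/-- The **Kerr-star angle shift** `φ̄(r)` of Shlapentokh-Rothman, CMP 329 (2014), §1.2.1
(`φ* = φ + φ̄(r)`, `dφ̄/dr = a/Δ`, defined up to a constant), taken for sub-extremal parameters as
`φ̄(r) = (a/(r₊ − r₋)) (log(r − r₊) − log(r − r₋))` on `(r₊, ∞)`. Junk values off `(r₊, ∞)` and for
`|a| ≥ M`. [cite: ShlapentokhRothman2014KleinGordon, §1.2.1] -/
def starAngle (M a r : ℝ) : ℝ :=
  a / (rPlus M a - rMinus M a) * (Real.log (r - rPlus M a) - Real.log (r - rMinus M a))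

/-- `dt̄/dr = (r² + a²)/Δ` on `(r₊, ∞)` for `|a| < M` (SR, CMP 329 (2014), §1.2.1).
[cite: ShlapentokhRothman2014KleinGordon, §1.2.1] -/
theorem hasDerivAt_starTime {M a r : ℝ} (h : IsSubextremal M a) (hr : rPlus M a < r) :
    HasDerivAt (starTime M a) ((r ^ 2 + a ^ 2) / delta M a r) r := by
  have hpm : 0 < rPlus M a - rMinus M a := sub_pos.2 h.rMinus_lt_rPlus
  have h1 : 0 < r - rPlus M a := sub_pos.2 hr
  have h2 : 0 < r - rMinus M a := sub_pos.2 (h.rMinus_lt_rPlus.trans hr)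
  have hl1 : HasDerivAt (fun s ↦ Real.log (s - rPlus M a)) (1 / (r - rPlus M a)) r := by
    have := ((hasDerivAt_id r).sub_const (rPlus M a)).log h1.ne'
    simpa using this
  have hl2 : HasDerivAt (fun s ↦ Real.log (s - rMinus M a)) (1 / (r - rMinus M a)) r := by
    have := ((hasDerivAt_id r).sub_const (rMinus M a)).log h2.ne'
    simpa using this
  have hsum : HasDerivAt (starTime M a)
      (1 + 2 * M * rPlus M a / (rPlus M a - rMinus M a) * (1 / (r - rPlus M a)) -
        2 * M * rMinus M a / (rPlus M a - rMinus M a) * (1 / (r - rMinus M a))) r := by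
    have hfun : starTime M a = fun s ↦ s + 2 * M * rPlus M a / (rPlus M a - rMinus M a) *
        Real.log (s - rPlus M a) - 2 * M * rMinus M a / (rPlus M a - rMinus M a) *
          Real.log (s - rMinus M a) := rfl
    rw [hfun]
    exact ((hasDerivAt_id r).add (hl1.const_mul _)).sub (hl2.const_mul _)
  have hΔ : delta M a r = (r - rPlus M a) * (r - rMinus M a) := delta_eq_mul h.le r
  have hprod := rPlus_mul_rMinus (le_of_lt h)
  have hs := rPlus_add_rMinus M a
  refine hsum.congr_deriv ?_
  rw [hΔ, eq_div_iff (mul_pos h1 h2).ne']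
  field_simp
  linear_combination (rPlus M a - rMinus M a) * hprod - (r * (rPlus M a - rMinus M a)) * hs

/-- `dφ̄/dr = a/Δ` on `(r₊, ∞)` for `|a| < M` (SR, CMP 329 (2014), §1.2.1).
[cite: ShlapentokhRothman2014KleinGordon, §1.2.1] -/
theorem hasDerivAt_starAngle {M a r : ℝ} (h : IsSubextremal M a) (hr : rPlus M a < r) :
    HasDerivAt (starAngle M a) (a / delta M a r) r := by
  have hpm : 0 < rPlus M a - rMinus M a := sub_pos.2 h.rMinus_lt_rPlus
  have h1 : 0 < r - rPlus M a := sub_pos.2 hr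
  have h2 : 0 < r - rMinus M a := sub_pos.2 (h.rMinus_lt_rPlus.trans hr)
  have hl1 : HasDerivAt (fun s ↦ Real.log (s - rPlus M a)) (1 / (r - rPlus M a)) r := by
    have := ((hasDerivAt_id r).sub_const (rPlus M a)).log h1.ne'
    simpa using this
  have hl2 : HasDerivAt (fun s ↦ Real.log (s - rMinus M a)) (1 / (r - rMinus M a)) r := by
    have := ((hasDerivAt_id r).sub_const (rMinus M a)).log h2.ne'
    simpa using this
  have hsum : HasDerivAt (starAngle M a)
      (a / (rPlus M a - rMinus M a) * (1 / (r - rPlus M a) - 1 / (r - rMinus M a))) r := by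
    have hfun : starAngle M a = fun s ↦ a / (rPlus M a - rMinus M a) *
        (Real.log (s - rPlus M a) - Real.log (s - rMinus M a)) := rfl
    rw [hfun]
    exact (hl1.sub hl2).const_mul _
  have hΔ : delta M a r = (r - rPlus M a) * (r - rMinus M a) := delta_eq_mul h.le r
  refine hsum.congr_deriv ?_
  rw [hΔ, eq_div_iff (mul_pos h1 h2).ne']
  field_simp
  ring

/-- `t̄` is `C^∞` on `(r₊, ∞)` for `|a| < M`. [folklore] -/
theorem contDiffOn_starTime {M a : ℝ} (h : IsSubextremal M a) {n : WithTop ℕ∞} :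
    ContDiffOn ℝ n (starTime M a) (Ioi (rPlus M a)) := by
  have h1 : ∀ r ∈ Ioi (rPlus M a), r - rPlus M a ≠ 0 := fun r hr ↦ (sub_pos.2 hr).ne'
  have h2 : ∀ r ∈ Ioi (rPlus M a), r - rMinus M a ≠ 0 := fun r hr ↦
    (sub_pos.2 (h.rMinus_lt_rPlus.trans hr)).ne'
  unfold starTime
  apply_rules [ContDiffOn.sub, ContDiffOn.add, ContDiffOn.mul, contDiffOn_id, contDiffOn_const,
    ContDiffOn.log]

/-- `φ̄` is `C^∞` on `(r₊, ∞)` for `|a| < M`. [folklore] -/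
theorem contDiffOn_starAngle {M a : ℝ} (h : IsSubextremal M a) {n : WithTop ℕ∞} :
    ContDiffOn ℝ n (starAngle M a) (Ioi (rPlus M a)) := by
  have h1 : ∀ r ∈ Ioi (rPlus M a), r - rPlus M a ≠ 0 := fun r hr ↦ (sub_pos.2 hr).ne'
  have h2 : ∀ r ∈ Ioi (rPlus M a), r - rMinus M a ≠ 0 := fun r hr ↦
    (sub_pos.2 (h.rMinus_lt_rPlus.trans hr)).ne'
  unfold starAngle
  apply_rules [ContDiffOn.sub, ContDiffOn.add, ContDiffOn.mul, contDiffOn_id, contDiffOn_const,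
    ContDiffOn.log]

/-- **Lower bound of the shift at infinity**: `t̄(r) − r ≥ −2M r₋` for `r ≥ r₊ + 1` and `|a| < M`
(`log(r − r₊) ≥ 0` and `log(r − r₋) ≤ log(r − r₊) + (r₊ − r₋)` there). This bounds the modulus
`|e^{iω(t̄ − r)}| = e^{−Im ω (t̄ − r)} ≤ e^{2M r₋ Im ω}` of the phase relating Boyer–Lindquist modes to
Kerr–Schild-leaf profiles. [folklore] -/
theorem neg_le_starTime_sub_self {M a r : ℝ} (h : IsSubextremal M a) (hr : rPlus M a + 1 ≤ r) :
    -(2 * M * rMinus M a) ≤ starTime M a r - r := by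
  have hpm : 0 < rPlus M a - rMinus M a := sub_pos.2 h.rMinus_lt_rPlus
  have hM : 0 < M := h.pos
  have hm0 : 0 ≤ rMinus M a := h.rMinus_nonneg
  have h1 : 1 ≤ r - rPlus M a := by linarith
  have h2 : 0 < r - rMinus M a := by linarith [h.rMinus_lt_rPlus]
  have hL1 : 0 ≤ Real.log (r - rPlus M a) := Real.log_nonneg h1
  -- `log(r − r₋) − log(r − r₊) = log((r − r₋)/(r − r₊)) ≤ (r − r₋)/(r − r₊) − 1 ≤ r₊ − r₋`
  have hL2 : Real.log (r - rMinus M a) ≤ Real.log (r - rPlus M a) + (rPlus M a - rMinus M a) := by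
    have hq : 0 < (r - rMinus M a) / (r - rPlus M a) := div_pos h2 (by linarith)
    have hlog := Real.log_le_sub_one_of_pos hq
    rw [Real.log_div h2.ne' (by linarith)] at hlog
    have hfrac : (r - rMinus M a) / (r - rPlus M a) - 1 ≤ rPlus M a - rMinus M a := by
      rw [div_sub_one (by linarith : r - rPlus M a ≠ 0), div_le_iff₀ (by linarith)]
      nlinarith
    linarith
  have key : -(rMinus M a * (rPlus M a - rMinus M a)) ≤
      rPlus M a * Real.log (r - rPlus M a) - rMinus M a * Real.log (r - rMinus M a) := by
    nlinarith [mul_le_mul_of_nonneg_left hL2 hm0, mul_nonneg (sub_pos.2 h.rMinus_lt_rPlus).le hL1]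
  have hexpr : starTime M a r - r = 2 * M / (rPlus M a - rMinus M a) *
      (rPlus M a * Real.log (r - rPlus M a) - rMinus M a * Real.log (r - rMinus M a)) := by
    unfold starTime
    field_simp
    ring
  rw [hexpr]
  have hc : 0 < 2 * M / (rPlus M a - rMinus M a) := by positivity
  calc -(2 * M * rMinus M a)
      = 2 * M / (rPlus M a - rMinus M a) * (-(rMinus M a * (rPlus M a - rMinus M a))) := by
        field_simp
    _ ≤ _ := mul_le_mul_of_nonneg_left key hc.le

/-! ### Uniform bounds on the slice `{r > r₀}`, `r₀ > 0`: `‖∇r‖` and `‖Dℓ⃗‖` -/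

section Bounds

variable {a r₀ : ℝ} {y : E3}

/-- `r > r₀` and `r > 0` for points of `Kerr.slice a r₀`. [folklore] -/
theorem lt_radius_of_mem_slice (hy : y ∈ slice a r₀) : r₀ < radius a (E4.ofTimeSpace 0 y) :=
  (le_max_left r₀ 0).trans_lt hy

/-- `r > 0` for points of `Kerr.slice a r₀`. [folklore] -/
theorem radius_pos_of_mem_slice (hy : y ∈ slice a r₀) : 0 < radius a (E4.ofTimeSpace 0 y) :=
  (le_max_right r₀ 0).trans_lt hy

/-- The coordinate projections of `E3` have operator norm `≤ 1`. [folklore] -/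
theorem norm_proj_le_one (i : Fin 3) : ‖(EuclideanSpace.proj i : E3 →L[ℝ] ℝ)‖ ≤ 1 := by
  refine ContinuousLinearMap.opNorm_le_bound _ zero_le_one fun v ↦ ?_
  rw [one_mul]
  exact PiLp.norm_apply_le v i

/-- `‖∇r‖² = (r² + a²)/Σ ≤ 1 + a²/r²` on the leaf (`Σ ≥ r²`). [folklore] -/
theorem norm_radiusGrad_sq_le (hr : 0 < radius a (E4.ofTimeSpace 0 y)) :
    ‖radiusGrad a y‖ ^ 2 ≤ 1 + a ^ 2 / radius a (E4.ofTimeSpace 0 y) ^ 2 := by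
  rw [radiusGrad, innerSL_apply_norm, ← real_inner_self_eq_norm_sq, inner_radiusGradVec_self hr]
  have hS := sq_le_blSigma hr
  have hr2 : 0 < radius a (E4.ofTimeSpace 0 y) ^ 2 := by positivity
  calc (radius a (E4.ofTimeSpace 0 y) ^ 2 + a ^ 2) / blSigma a y
      ≤ (radius a (E4.ofTimeSpace 0 y) ^ 2 + a ^ 2) / radius a (E4.ofTimeSpace 0 y) ^ 2 :=
        div_le_div_of_nonneg_left (by positivity) hr2 hS
    _ = 1 + a ^ 2 / radius a (E4.ofTimeSpace 0 y) ^ 2 := by field_simp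

/-- **Uniform bound of the gradient of the Kerr–Schild radius on `{r > r₀}`**:
`‖∇r‖ ≤ 1 + |a|/r₀` (`r₀ > 0`). [folklore] -/
theorem norm_radiusGrad_le (hr₀ : 0 < r₀) (hy : y ∈ slice a r₀) :
    ‖radiusGrad a y‖ ≤ 1 + |a| / r₀ := by
  have hr := radius_pos_of_mem_slice hy
  have hr₀r := lt_radius_of_mem_slice hy
  have h1 : ‖radiusGrad a y‖ ^ 2 ≤ (1 + |a| / r₀) ^ 2 := by
    calc ‖radiusGrad a y‖ ^ 2 ≤ 1 + a ^ 2 / radius a (E4.ofTimeSpace 0 y) ^ 2 :=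
          norm_radiusGrad_sq_le hr
      _ ≤ 1 + a ^ 2 / r₀ ^ 2 := by gcongr
      _ ≤ (1 + |a| / r₀) ^ 2 := by
          have hsq : (|a| / r₀) ^ 2 = a ^ 2 / r₀ ^ 2 := by rw [div_pow, sq_abs]
          nlinarith [div_nonneg (abs_nonneg a) hr₀.le]
  exact (abs_le_of_sq_le_sq' h1 (by positivity)).2

/-- Derivative of `ℓ₃ = z/r` along the leaf: `D(ℓ₃) = z · (−r⁻² dr) + r⁻¹ dz`. [folklore] -/
theorem hasFDerivAt_nullSpatial_two (hr : 0 < radius a (E4.ofTimeSpace 0 y)) :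
    HasFDerivAt (fun y ↦ nullSpatial a (E4.ofTimeSpace 0 y) 2)
      (y 2 • ((-(radius a (E4.ofTimeSpace 0 y) ^ 2)⁻¹) • radiusGrad a y) +
        (radius a (E4.ofTimeSpace 0 y))⁻¹ • (EuclideanSpace.proj 2 : E3 →L[ℝ] ℝ)) y := by
  have hfun : (fun y : E3 ↦ nullSpatial a (E4.ofTimeSpace 0 y) 2) =
      fun y ↦ y 2 * (radius a (E4.ofTimeSpace 0 y))⁻¹ := by
    funext y
    rw [nullSpatial_apply, fin_succ_two_eq_three, nullCovectorFun_ofTimeSpace_three, div_eq_mul_inv]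
  rw [hfun]
  have hR := hasFDerivAt_radius_slice hr
  have hinv : HasFDerivAt (fun y : E3 ↦ (radius a (E4.ofTimeSpace 0 y))⁻¹)
      ((-(radius a (E4.ofTimeSpace 0 y) ^ 2)⁻¹) • radiusGrad a y) y :=
    (hasDerivAt_inv hr.ne').comp_hasFDerivAt y hR
  exact ((EuclideanSpace.proj (2 : Fin 3) : E3 →L[ℝ] ℝ).hasFDerivAt).mul hinv

/-- Derivative of `r² + a²` along the leaf: `2r dr`. [folklore] -/
theorem hasFDerivAt_radius_sq_add_sq (hr : 0 < radius a (E4.ofTimeSpace 0 y)) :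
    HasFDerivAt (fun y : E3 ↦ radius a (E4.ofTimeSpace 0 y) ^ 2 + a ^ 2)
      (radius a (E4.ofTimeSpace 0 y) • radiusGrad a y +
        radius a (E4.ofTimeSpace 0 y) • radiusGrad a y) y := by
  have hR := hasFDerivAt_radius_slice hr
  have h := (hR.mul hR).add_const (a ^ 2)
  refine h.congr_of_eventuallyEq (Eventually.of_forall fun z ↦ ?_)
  simp [sq]

/-- Derivative of `ℓ₁ = (r x + a y)/(r² + a²)` along the leaf (product/quotient rule).
[folklore] -/
theorem hasFDerivAt_nullSpatial_zero (hr : 0 < radius a (E4.ofTimeSpace 0 y)) :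
    HasFDerivAt (fun y ↦ nullSpatial a (E4.ofTimeSpace 0 y) 0)
      ((radius a (E4.ofTimeSpace 0 y) * y 0 + a * y 1) •
          ((-((radius a (E4.ofTimeSpace 0 y) ^ 2 + a ^ 2) ^ 2)⁻¹) •
            (radius a (E4.ofTimeSpace 0 y) • radiusGrad a y +
              radius a (E4.ofTimeSpace 0 y) • radiusGrad a y)) +
        (radius a (E4.ofTimeSpace 0 y) ^ 2 + a ^ 2)⁻¹ •
          (radius a (E4.ofTimeSpace 0 y) • (EuclideanSpace.proj 0 : E3 →L[ℝ] ℝ) +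
            y 0 • radiusGrad a y + a • (EuclideanSpace.proj 1 : E3 →L[ℝ] ℝ))) y := by
  have hfun : (fun y : E3 ↦ nullSpatial a (E4.ofTimeSpace 0 y) 0) =
      fun y ↦ (radius a (E4.ofTimeSpace 0 y) * y 0 + a * y 1) *
        (radius a (E4.ofTimeSpace 0 y) ^ 2 + a ^ 2)⁻¹ := by
    funext y
    rw [nullSpatial_apply, Fin.succ_zero_eq_one, nullCovectorFun_apply_one, radius_ofTimeSpace,
      ofTimeSpace_apply_one_eq, ofTimeSpace_apply_two_eq, div_eq_mul_inv]
  rw [hfun]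
  have hR := hasFDerivAt_radius_slice hr
  have hN := hasFDerivAt_radius_sq_add_sq (a := a) hr
  have hN0 : radius a (E4.ofTimeSpace 0 y) ^ 2 + a ^ 2 ≠ 0 := by positivity
  have hinv := (hasDerivAt_inv hN0).comp_hasFDerivAt y hN
  have hP : HasFDerivAt (fun y : E3 ↦ radius a (E4.ofTimeSpace 0 y) * y 0 + a * y 1)
      (radius a (E4.ofTimeSpace 0 y) • (EuclideanSpace.proj 0 : E3 →L[ℝ] ℝ) +
        y 0 • radiusGrad a y + a • (EuclideanSpace.proj 1 : E3 →L[ℝ] ℝ)) y :=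
    (hR.mul ((EuclideanSpace.proj (0 : Fin 3) : E3 →L[ℝ] ℝ).hasFDerivAt)).add
      (((EuclideanSpace.proj (1 : Fin 3) : E3 →L[ℝ] ℝ).hasFDerivAt).const_mul a)
  exact hP.mul hinv

/-- Derivative of `ℓ₂ = (r y − a x)/(r² + a²)` along the leaf (product/quotient rule).
[folklore] -/
theorem hasFDerivAt_nullSpatial_one (hr : 0 < radius a (E4.ofTimeSpace 0 y)) :
    HasFDerivAt (fun y ↦ nullSpatial a (E4.ofTimeSpace 0 y) 1)
      ((radius a (E4.ofTimeSpace 0 y) * y 1 - a * y 0) •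
          ((-((radius a (E4.ofTimeSpace 0 y) ^ 2 + a ^ 2) ^ 2)⁻¹) •
            (radius a (E4.ofTimeSpace 0 y) • radiusGrad a y +
              radius a (E4.ofTimeSpace 0 y) • radiusGrad a y)) +
        (radius a (E4.ofTimeSpace 0 y) ^ 2 + a ^ 2)⁻¹ •
          (radius a (E4.ofTimeSpace 0 y) • (EuclideanSpace.proj 1 : E3 →L[ℝ] ℝ) +
            y 1 • radiusGrad a y - a • (EuclideanSpace.proj 0 : E3 →L[ℝ] ℝ))) y := by
  have hfun : (fun y : E3 ↦ nullSpatial a (E4.ofTimeSpace 0 y) 1) =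
      fun y ↦ (radius a (E4.ofTimeSpace 0 y) * y 1 - a * y 0) *
        (radius a (E4.ofTimeSpace 0 y) ^ 2 + a ^ 2)⁻¹ := by
    funext y
    rw [nullSpatial_apply, Fin.succ_one_eq_two, nullCovectorFun_apply_two, radius_ofTimeSpace,
      ofTimeSpace_apply_one_eq, ofTimeSpace_apply_two_eq, div_eq_mul_inv]
  rw [hfun]
  have hR := hasFDerivAt_radius_slice hr
  have hN := hasFDerivAt_radius_sq_add_sq (a := a) hr
  have hN0 : radius a (E4.ofTimeSpace 0 y) ^ 2 + a ^ 2 ≠ 0 := by positivity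
  have hinv := (hasDerivAt_inv hN0).comp_hasFDerivAt y hN
  have hP : HasFDerivAt (fun y : E3 ↦ radius a (E4.ofTimeSpace 0 y) * y 1 - a * y 0)
      (radius a (E4.ofTimeSpace 0 y) • (EuclideanSpace.proj 1 : E3 →L[ℝ] ℝ) +
        y 1 • radiusGrad a y - a • (EuclideanSpace.proj 0 : E3 →L[ℝ] ℝ)) y :=
    (hR.mul ((EuclideanSpace.proj (1 : Fin 3) : E3 →L[ℝ] ℝ).hasFDerivAt)).sub
      (((EuclideanSpace.proj (0 : Fin 3) : E3 →L[ℝ] ℝ).hasFDerivAt).const_mul a)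
  exact hP.mul hinv

/-- Arithmetic of the bounds: with `B = r + |a|`, `N = r² + a² ≥ B²/2`. [folklore] -/
theorem sq_add_sq_ge_half (r a : ℝ) : (r + |a|) ^ 2 / 2 ≤ r ^ 2 + a ^ 2 := by
  nlinarith [sq_nonneg (r - |a|), sq_abs a]

/-- **Bound for the derivative of `ℓ₁`, `ℓ₂` on `{r > r₀}`**: with `K = 1 + |a|/r₀`,
`‖Dℓ₁‖, ‖Dℓ₂‖ ≤ (10K + 2)/r₀`. [folklore] -/
theorem norm_fderiv_nullSpatial_zero_one_le (hr₀ : 0 < r₀) (hy : y ∈ slice a r₀) (P s : ℝ)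
    (hP : |P| ≤ (radius a (E4.ofTimeSpace 0 y) + |a|) ^ 2) (hs : |s| ≤ |a|) (i j : Fin 3) (c : ℝ)
    (hc : |c| ≤ radius a (E4.ofTimeSpace 0 y) + |a|) :
    ‖P • ((-((radius a (E4.ofTimeSpace 0 y) ^ 2 + a ^ 2) ^ 2)⁻¹) •
          (radius a (E4.ofTimeSpace 0 y) • radiusGrad a y +
            radius a (E4.ofTimeSpace 0 y) • radiusGrad a y)) +
        (radius a (E4.ofTimeSpace 0 y) ^ 2 + a ^ 2)⁻¹ •
          (radius a (E4.ofTimeSpace 0 y) • (EuclideanSpace.proj i : E3 →L[ℝ] ℝ) +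
            c • radiusGrad a y + s • (EuclideanSpace.proj j : E3 →L[ℝ] ℝ))‖ ≤
      (10 * (1 + |a| / r₀) + 2) / r₀ := by
  set R : ℝ := radius a (E4.ofTimeSpace 0 y) with hRdef
  set K : ℝ := 1 + |a| / r₀ with hKdef
  set B : ℝ := R + |a| with hBdef
  set N : ℝ := R ^ 2 + a ^ 2 with hNdef
  have hR : 0 < R := radius_pos_of_mem_slice hy
  have hr₀R : r₀ < R := lt_radius_of_mem_slice hy
  have hK1 : 1 ≤ K := le_add_of_nonneg_right (div_nonneg (abs_nonneg a) hr₀.le)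
  have hdr : ‖radiusGrad a y‖ ≤ K := norm_radiusGrad_le hr₀ hy
  have hB : R ≤ B := le_add_of_nonneg_right (abs_nonneg a)
  have hBpos : 0 < B := hR.trans_le hB
  have hN : B ^ 2 / 2 ≤ N := sq_add_sq_ge_half R a
  have hNpos : 0 < N := by positivity
  have hpi : ‖(EuclideanSpace.proj i : E3 →L[ℝ] ℝ)‖ ≤ 1 := norm_proj_le_one i
  have hpj : ‖(EuclideanSpace.proj j : E3 →L[ℝ] ℝ)‖ ≤ 1 := norm_proj_le_one j
  -- the two summands
  have hN' : ‖R • radiusGrad a y + R • radiusGrad a y‖ ≤ 2 * B * K := by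
    refine (norm_add_le _ _).trans ?_
    rw [norm_smul, Real.norm_eq_abs, abs_of_pos hR]
    nlinarith [mul_le_mul hB hdr (norm_nonneg _) hBpos.le]
  have h1 : ‖P • ((-(N ^ 2)⁻¹) • (R • radiusGrad a y + R • radiusGrad a y))‖ ≤ 8 * K / B := by
    rw [norm_smul, norm_smul, norm_neg, norm_inv, norm_pow, Real.norm_eq_abs, Real.norm_eq_abs,
      abs_of_pos hNpos]
    have hP' : |P| ≤ B ^ 2 := hP
    calc |P| * ((N ^ 2)⁻¹ * ‖R • radiusGrad a y + R • radiusGrad a y‖)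
        ≤ B ^ 2 * ((N ^ 2)⁻¹ * (2 * B * K)) := by gcongr
      _ ≤ B ^ 2 * (((B ^ 2 / 2) ^ 2)⁻¹ * (2 * B * K)) := by gcongr
      _ = 8 * K / B := by field_simp; ring
  have h2 : ‖N⁻¹ • (R • (EuclideanSpace.proj i : E3 →L[ℝ] ℝ) + c • radiusGrad a y +
      s • (EuclideanSpace.proj j : E3 →L[ℝ] ℝ))‖ ≤ 2 * (1 + K) / B := by
    rw [norm_smul, norm_inv, Real.norm_eq_abs, abs_of_pos hNpos]
    have hin : ‖R • (EuclideanSpace.proj i : E3 →L[ℝ] ℝ) + c • radiusGrad a y +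
        s • (EuclideanSpace.proj j : E3 →L[ℝ] ℝ)‖ ≤ B + B * K := by
      refine (norm_add₃_le).trans ?_
      rw [norm_smul, norm_smul, norm_smul, Real.norm_eq_abs, Real.norm_eq_abs, Real.norm_eq_abs,
        abs_of_pos hR]
      have n1 := norm_nonneg (EuclideanSpace.proj i : E3 →L[ℝ] ℝ)
      have n2 := norm_nonneg (EuclideanSpace.proj j : E3 →L[ℝ] ℝ)
      have e1 : R * ‖(EuclideanSpace.proj i : E3 →L[ℝ] ℝ)‖ ≤ R := by nlinarith
      have e2 : |c| * ‖radiusGrad a y‖ ≤ B * K :=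
        mul_le_mul hc hdr (norm_nonneg _) hBpos.le
      have e3 : |s| * ‖(EuclideanSpace.proj j : E3 →L[ℝ] ℝ)‖ ≤ |a| := by
        nlinarith [abs_nonneg s]
      linarith
    calc N⁻¹ * ‖R • (EuclideanSpace.proj i : E3 →L[ℝ] ℝ) + c • radiusGrad a y +
          s • (EuclideanSpace.proj j : E3 →L[ℝ] ℝ)‖
        ≤ (B ^ 2 / 2)⁻¹ * (B + B * K) := by gcongr
      _ = 2 * (1 + K) / B := by field_simp
  refine (norm_add_le _ _).trans ?_
  have hsum : 8 * K / B + 2 * (1 + K) / B ≤ (10 * K + 2) / r₀ := by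
    rw [← add_div, div_le_div_iff₀ hBpos hr₀]
    nlinarith [hr₀R.le.trans hB]
  linarith [h1, h2, hsum]

/-- **Bound for the derivative of `ℓ₃` on `{r > r₀}`**: `‖Dℓ₃‖ ≤ (K + 1)/r₀`, `K = 1 + |a|/r₀`.
[folklore] -/
theorem norm_fderiv_nullSpatial_two_le (hr₀ : 0 < r₀) (hy : y ∈ slice a r₀) :
    ‖y 2 • ((-(radius a (E4.ofTimeSpace 0 y) ^ 2)⁻¹) • radiusGrad a y) +
        (radius a (E4.ofTimeSpace 0 y))⁻¹ • (EuclideanSpace.proj 2 : E3 →L[ℝ] ℝ)‖ ≤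
      (1 + |a| / r₀ + 1) / r₀ := by
  set R : ℝ := radius a (E4.ofTimeSpace 0 y) with hRdef
  set K : ℝ := 1 + |a| / r₀ with hKdef
  have hR : 0 < R := radius_pos_of_mem_slice hy
  have hr₀R : r₀ < R := lt_radius_of_mem_slice hy
  have hdr : ‖radiusGrad a y‖ ≤ K := norm_radiusGrad_le hr₀ hy
  have hz : |y 2| ≤ R := abs_apply_two_le_radius hR
  have hp : ‖(EuclideanSpace.proj 2 : E3 →L[ℝ] ℝ)‖ ≤ 1 := norm_proj_le_one 2
  refine (norm_add_le _ _).trans ?_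
  rw [norm_smul, norm_smul, norm_smul, norm_neg, norm_inv, norm_inv, norm_pow, Real.norm_eq_abs,
    Real.norm_eq_abs, abs_of_pos hR]
  have h1 : |y 2| * ((R ^ 2)⁻¹ * ‖radiusGrad a y‖) ≤ K / R := by
    calc |y 2| * ((R ^ 2)⁻¹ * ‖radiusGrad a y‖) ≤ R * ((R ^ 2)⁻¹ * K) := by gcongr
      _ = K / R := by field_simp
  have h2 : R⁻¹ * ‖(EuclideanSpace.proj 2 : E3 →L[ℝ] ℝ)‖ ≤ 1 / R := by
    calc R⁻¹ * ‖(EuclideanSpace.proj 2 : E3 →L[ℝ] ℝ)‖ ≤ R⁻¹ * 1 := by gcongr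
      _ = 1 / R := by rw [mul_one, one_div]
  have h3 : K / R + 1 / R ≤ (K + 1) / r₀ := by
    rw [← add_div]
    gcongr
  linarith

/-- **The Fréchet derivative of `y ↦ ℓ⃗(0, y)` is uniformly bounded on `{r > r₀}`** (`r₀ > 0`):
there is `L'` with `HasFDerivAt (y ↦ ℓ⃗(0, y)) L' y` and `‖L'‖ ≤ (21 K + 5)/r₀`, `K = 1 + |a|/r₀`
(assembling the component derivatives; `ℓ⃗` is the unit vector `n̂(θ, φ*)`, whose angular
derivatives are `O(1/r)` in these coordinates). [folklore] -/
theorem exists_hasFDerivAt_nullSpatial_slice (hr₀ : 0 < r₀) (hy : y ∈ slice a r₀) :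
    ∃ L' : E3 →L[ℝ] E3, HasFDerivAt (fun y ↦ nullSpatial a (E4.ofTimeSpace 0 y)) L' y ∧
      ‖L'‖ ≤ (21 * (1 + |a| / r₀) + 5) / r₀ := by
  have hR : 0 < radius a (E4.ofTimeSpace 0 y) := radius_pos_of_mem_slice hy
  set R : ℝ := radius a (E4.ofTimeSpace 0 y) with hRdef
  have habs : ∀ i : Fin 3, |y i| ≤ R + |a| := fun i ↦ abs_apply_le_radius_add_abs hR i
  -- the three component derivatives and their bounds
  obtain ⟨L₀, hL₀, hb₀⟩ : ∃ L₀ : E3 →L[ℝ] ℝ,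
      HasFDerivAt (fun y ↦ nullSpatial a (E4.ofTimeSpace 0 y) 0) L₀ y ∧
        ‖L₀‖ ≤ (10 * (1 + |a| / r₀) + 2) / r₀ := by
    refine ⟨_, hasFDerivAt_nullSpatial_zero hR, norm_fderiv_nullSpatial_zero_one_le hr₀ hy _ _
      ?_ le_rfl 0 1 _ (habs 0)⟩
    calc |R * y 0 + a * y 1| ≤ |R * y 0| + |a * y 1| := abs_add_le _ _
      _ = R * |y 0| + |a| * |y 1| := by rw [abs_mul, abs_mul, abs_of_pos hR]
      _ ≤ R * (R + |a|) + |a| * (R + |a|) := by gcongr <;> exact habs _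
      _ = (R + |a|) ^ 2 := by ring
  obtain ⟨L₁, hL₁, hb₁⟩ : ∃ L₁ : E3 →L[ℝ] ℝ,
      HasFDerivAt (fun y ↦ nullSpatial a (E4.ofTimeSpace 0 y) 1) L₁ y ∧
        ‖L₁‖ ≤ (10 * (1 + |a| / r₀) + 2) / r₀ := by
    have h := norm_fderiv_nullSpatial_zero_one_le hr₀ hy (R * y 1 - a * y 0) (-a) ?_
      (by rw [abs_neg]) 1 0 (y 1) (habs 1)
    · refine ⟨_, hasFDerivAt_nullSpatial_one hR, ?_⟩
      simpa only [neg_smul, ← sub_eq_add_neg] using h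
    calc |R * y 1 - a * y 0| ≤ |R * y 1| + |a * y 0| := abs_sub _ _
      _ = R * |y 1| + |a| * |y 0| := by rw [abs_mul, abs_mul, abs_of_pos hR]
      _ ≤ R * (R + |a|) + |a| * (R + |a|) := by gcongr <;> exact habs _
      _ = (R + |a|) ^ 2 := by ring
  obtain ⟨L₂, hL₂, hb₂⟩ : ∃ L₂ : E3 →L[ℝ] ℝ,
      HasFDerivAt (fun y ↦ nullSpatial a (E4.ofTimeSpace 0 y) 2) L₂ y ∧
        ‖L₂‖ ≤ (1 + |a| / r₀ + 1) / r₀ :=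
    ⟨_, hasFDerivAt_nullSpatial_two hR, norm_fderiv_nullSpatial_two_le hr₀ hy⟩
  -- assemble
  set Ls : Fin 3 → (E3 →L[ℝ] ℝ) := ![L₀, L₁, L₂] with hLs
  set L' : E3 →L[ℝ] E3 := ∑ i : Fin 3, (Ls i).smulRight (EuclideanSpace.single i (1 : ℝ)) with hL'
  have hproj : ∀ i : Fin 3, (PiLp.proj 2 (fun _ : Fin 3 ↦ ℝ) i ∘L L') = Ls i := by
    intro i
    ext v
    simp only [hL', ContinuousLinearMap.coe_comp, Function.comp_apply, PiLp.proj_apply,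
      FunLike.coe_sum, Finset.sum_apply, ContinuousLinearMap.smulRight_apply]
    fin_cases i <;> simp [Fin.sum_univ_three]
  refine ⟨L', ?_, ?_⟩
  · refine hasFDerivWithinAt_univ.mp (hasFDerivWithinAt_euclidean.mpr fun i ↦ ?_)
    rw [hproj i]
    fin_cases i
    · exact hL₀.hasFDerivWithinAt
    · exact hL₁.hasFDerivWithinAt
    · exact hL₂.hasFDerivWithinAt
  · have hn : ∀ i : Fin 3, ‖(Ls i).smulRight (EuclideanSpace.single i (1 : ℝ))‖ = ‖Ls i‖ := by
      intro i
      rw [ContinuousLinearMap.norm_smulRight_apply, EuclideanSpace.single, PiLp.norm_single, norm_one,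
        mul_one]
    calc ‖L'‖ ≤ ∑ i : Fin 3, ‖(Ls i).smulRight (EuclideanSpace.single i (1 : ℝ))‖ := norm_sum_le _ _
      _ = ‖L₀‖ + ‖L₁‖ + ‖L₂‖ := by
          simp only [hn, Fin.sum_univ_three]
          rfl
      _ ≤ (10 * (1 + |a| / r₀) + 2) / r₀ + (10 * (1 + |a| / r₀) + 2) / r₀ +
          (1 + |a| / r₀ + 1) / r₀ := by gcongr
      _ = (21 * (1 + |a| / r₀) + 5) / r₀ := by field_simp; ring

/-- **Corollary**: the Fréchet derivative `fderiv ℝ (y ↦ ℓ⃗(0, y)) y` has norm `≤ (21K + 5)/r₀` on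
`{r > r₀}`. [folklore] -/
theorem norm_fderiv_nullSpatial_slice_le (hr₀ : 0 < r₀) (hy : y ∈ slice a r₀) :
    ‖fderiv ℝ (fun y ↦ nullSpatial a (E4.ofTimeSpace 0 y)) y‖ ≤ (21 * (1 + |a| / r₀) + 5) / r₀ := by
  obtain ⟨L', hL', hb⟩ := exists_hasFDerivAt_nullSpatial_slice hr₀ hy
  rwa [hL'.fderiv]

end Bounds

end Literature.Geometry.Lorentzian.Kerr

end
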